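import Summits.ResolutionOfSingularities.ResolutionOfSingularities.Theorems.WeightedInvariantIota3TauDescentDoorAdm
import Summits.ResolutionOfSingularities.ResolutionOfSingularities.Theorems.WeightedInvariantIota3TauDescentFirstOrder
import HarnessLib

/-!
# (desc-τ), CASE B: TOOLS FOR THE INDUCTION STEP OF (ADAPT-adm) — prime-element bookkeeping and two-dimensional quasi-regularity
# (door `HypersurfaceCentreConstruction`, stmt-ResolutionOfSingularities-19897; gap (1) (desc-τ) of the P3 rung `stub_keyRungGrHomLE_three`)

Topic: `Summits/ResolutionOfSingularities/ResolutionOfSingularities/Theorems`. Helper for the door item `HypersurfaceCentreConstruction`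
(stmt-ResolutionOfSingularities-19897, route `WeightedInvariant`), line `local-engine`, def-free.  Elementary lemmas consumed by the induction step
of (ADAPT-adm) (…Iota3TauDescentAdmStep, memo TAU-DESCENT-A.md §7 (ii)):

* `Iota3.pow_sub_pow_mem_mul_pow` (`A - B ∈ I`, `A, B ∈ M` ⟹ `A^{n+1} - B^{n+1} ∈ I Mⁿ`), `Iota3.span_pair_pow_le_span_pair_pow` (`(X,Y)ⁿ ≤ (X, Yⁿ)`);
* `Iota3.exists_dvd_of_prime_pow_succ_dvd` — in a domain, `π` prime, `π ∤ s`, `π ∤ ζ`, `π^{M+1} ∣ s(ζG - Uπ^M)` ⟹ `π ∣ ζ w - U` for some `w`;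
* `Iota3.not_dvd_of_span_pair_eq`, **`Iota3.mem_maximalIdeal_of_mul_pow_mem`** — two-dimensional quasi-regularity: `𝔪 = (X, Y)` regular,
  `λ Y^ν ∈ (X) + 𝔪^{ν+1}` ⟹ `λ ∈ 𝔪`;
* `Iota3.algebraMap_sub_mul_pow_mem_span` — if `Y/1 = a y₁ + γ X₀^k` in `T_P`, `P = (X₀, Y)`, and `γ ≡ c (mod 𝔪_{T_P})` with `c ∈ T`, then
  `(Y - c X₀^k)/1 ∈ (y₁, X₀^{k+1}) T_P`.

[OURS · L1 W4.3 · (desc-τ) case B, tools]  Replaces the role of NO printed item; NOT a statement of the manuscript under review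
[claim: Hironaka2017, status: under-review]; candidates stay candidates; AI work, weaker than expert review.  No definition; no axiom.

## References

* H. Matsumura, *Commutative Ring Theory* (1986), Thm. 14.2, Thm. 14.3, Thm. 16.2. [Matsumura1987]
-/

noncomputable section

set_option linter.dupNamespace false -- mandated namespace `Summit.<Summit>.<Problem>` of this single-conjunct summit

open IsLocalRing Literature.AlgebraicGeometry.Resolution
open Summit.ResolutionOfSingularities.ResolutionOfSingularities.Theorems
open Summit.ResolutionOfSingularities.ResolutionOfSingularities.Theorems.ContactCylinder

namespace Summit.ResolutionOfSingularities.ResolutionOfSingularities.Cruxes.HypersurfaceCentreConstruction.LocalEngine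

namespace Iota3

/-! ## §1 Elementary ideal lemmas -/

section Elementary

variable {R : Type*} [CommRing R]

/-- `A - B ∈ I`, `A, B ∈ M` ⟹ `A^{n+1} - B^{n+1} ∈ I · Mⁿ`. [folklore] -/
theorem pow_sub_pow_mem_mul_pow {A B : R} {I M : Ideal R} (hAB : A - B ∈ I) (hA : A ∈ M) (hB : B ∈ M) :
    ∀ n : ℕ, A ^ (n + 1) - B ^ (n + 1) ∈ I * M ^ n
  | 0 => by rw [pow_zero, Ideal.one_eq_top, Ideal.mul_top, zero_add, pow_one, pow_one]; exact hAB
  | n + 1 => by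
    have h : A ^ (n + 1 + 1) - B ^ (n + 1 + 1) = A * (A ^ (n + 1) - B ^ (n + 1)) + (A - B) * B ^ (n + 1) := by ring
    rw [h]
    refine Ideal.add_mem _ ?_ (Ideal.mul_mem_mul hAB (Ideal.pow_mem_pow hB (n + 1)))
    have h1 := Ideal.mul_mem_mul hA (pow_sub_pow_mem_mul_pow hAB hA hB n)
    rw [← mul_assoc, mul_comm M I, mul_assoc, ← pow_succ'] at h1
    exact h1

/-- `(X, Y)ⁿ ≤ (X, Yⁿ)`. [folklore] -/
theorem span_pair_pow_le_span_pair_pow (X Y : R) : ∀ n : ℕ, Ideal.span ({X, Y} : Set R) ^ n ≤ Ideal.span {X, Y ^ n}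
  | 0 => by
    rw [pow_zero, pow_zero, Ideal.one_eq_top]
    exact le_of_eq (Ideal.eq_top_of_isUnit_mem _ (Ideal.subset_span (Set.mem_insert_of_mem _ (Set.mem_singleton _)))
      isUnit_one).symm
  | n + 1 => by
    rw [pow_succ]
    refine (Ideal.mul_mono_left (span_pair_pow_le_span_pair_pow X Y n)).trans ?_
    rw [Ideal.mul_le]
    intro r hr s hs
    obtain ⟨a, b, rfl⟩ := Ideal.mem_span_pair.mp hr
    obtain ⟨c, d, rfl⟩ := Ideal.mem_span_pair.mp hs
    have : (a * X + b * Y ^ n) * (c * X + d * Y) = (a * (c * X + d * Y) + b * Y ^ n * c) * X + (b * d) * Y ^ (n + 1) := by ring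
    rw [this]
    exact Ideal.mem_span_pair.mpr ⟨_, _, rfl⟩

/-- **The prime-element bookkeeping of the step**: in a domain, `π` prime, `π ∤ s`, `π ∤ ζ`, and `π^{M+1} ∣ s (ζ G - U π^M)` give some `w` with
`π ∣ ζ w - U` (first `π^M ∣ G`, then cancel `π^M`). [folklore] -/
theorem exists_dvd_of_prime_pow_succ_dvd [IsDomain R] {π s ζ G U : R} (hπ : Prime π) (hs : ¬ π ∣ s) (hζ : ¬ π ∣ ζ)
    {M : ℕ} (h : π ^ (M + 1) ∣ s * (ζ * G - U * π ^ M)) : ∃ w : R, π ∣ ζ * w - U := by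
  have h1 : π ^ M ∣ s * (ζ * G - U * π ^ M) := (pow_dvd_pow π (Nat.le_succ M)).trans h
  have h2 : π ^ M ∣ (s * ζ) * G := by
    have : (s * ζ) * G = s * (ζ * G - U * π ^ M) + (s * U) * π ^ M := by ring
    rw [this]
    exact dvd_add h1 (Dvd.intro_left _ rfl)
  have hsζ : ¬ π ∣ s * ζ := fun hd => (hπ.dvd_or_dvd hd).elim hs hζ
  obtain ⟨w, rfl⟩ := hπ.pow_dvd_of_dvd_mul_left M hsζ h2
  refine ⟨w, ?_⟩
  have h4 : π ^ M * π ∣ π ^ M * (s * (ζ * w - U)) := by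
    have : s * (ζ * (π ^ M * w) - U * π ^ M) = π ^ M * (s * (ζ * w - U)) := by ring
    rwa [this, pow_succ] at h
  have h5 : π ∣ s * (ζ * w - U) := (mul_dvd_mul_iff_left (pow_ne_zero _ hπ.ne_zero)).mp h4
  exact (hπ.dvd_or_dvd h5).resolve_left hs

end Elementary

/-! ## §2 Two-dimensional quasi-regularity in the form used by the step -/

section DimTwo

variable {O : Type} [CommRing O] [IsRegularLocalRing O]

/-- In a two-dimensional regular local ring with `𝔪 = (X, Y)`: `Y ∉ (X)`. [cite: Matsumura1987, Thm. 14.2] -/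
theorem not_dvd_of_span_pair_eq (hdim : ringKrullDim O = (2 : ℕ)) {X Y : O} (hXY : Ideal.span {X, Y} = maximalIdeal O) : ¬ X ∣ Y := by
  rintro ⟨t, ht⟩
  have hspan : Ideal.span (Set.range ![X, Y]) = maximalIdeal O := by rw [Matrix.range_cons_cons_empty, hXY]
  have hli := linearIndependent_toCotangent_of_span_eq_maximalIdeal hdim ![X, Y] hspan
  have hmemv : ∀ i, (![X, Y] : Fin 2 → O) i ∈ maximalIdeal O := fun i => hspan ▸ Ideal.subset_span ⟨i, rfl⟩
  rw [linearIndependent_toCotangent_iff_forall_mem _ hmemv] at hli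
  have h0 := hli ![-t, 1] (by
    have : ∑ i, (![-t, 1] : Fin 2 → O) i * (![X, Y] : Fin 2 → O) i = 0 := by
      rw [Fin.sum_univ_two]
      simp only [Matrix.cons_val_zero, Matrix.cons_val_one]
      rw [ht]; ring
    rw [this]; exact Ideal.zero_mem _) 1
  simp only [Matrix.cons_val_one] at h0
  exact (IsLocalRing.maximalIdeal.isMaximal O).ne_top (Ideal.eq_top_of_isUnit_mem _ h0 isUnit_one)

/-- **Quasi-regularity, dimension two**: `𝔪 = (X, Y)` and `λ Y^ν ∈ (X) + 𝔪^{ν+1}` force `λ ∈ 𝔪`. [cite: Matsumura1987, Thm. 14.2, Thm. 16.2] -/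
theorem mem_maximalIdeal_of_mul_pow_mem (hdim : ringKrullDim O = (2 : ℕ)) {X Y : O} (hXY : Ideal.span {X, Y} = maximalIdeal O)
    {lam : O} {ν : ℕ} (h : lam * Y ^ ν ∈ Ideal.span {X} ⊔ maximalIdeal O ^ (ν + 1)) : lam ∈ maximalIdeal O := by
  haveI := isDomain_of_isRegularLocalRing O
  obtain ⟨hX2, -⟩ := LocalGameEFTSteepening.not_mem_sq_of_span_pair_eq hdim hXY
  have hX : X ∈ maximalIdeal O := hXY ▸ Ideal.subset_span (Set.mem_insert _ _)
  have hY : Y ∈ maximalIdeal O := hXY ▸ Ideal.subset_span (Set.mem_insert_of_mem _ (Set.mem_singleton _))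
  by_contra hlam
  have hlamu : IsUnit lam := by
    by_contra hu
    exact hlam ((IsLocalRing.mem_maximalIdeal _).mpr (mem_nonunits_iff.mpr hu))
  have hle : Ideal.span {X} ⊔ maximalIdeal O ^ (ν + 1) ≤ Ideal.span {X, Y ^ (ν + 1)} :=
    sup_le (Ideal.span_mono (Set.singleton_subset_iff.mpr (Set.mem_insert _ _)))
      (by rw [← hXY]; exact span_pair_pow_le_span_pair_pow X Y (ν + 1))
  have hmem : Y ^ ν ∈ Ideal.span ({X, Y ^ (ν + 1)} : Set O) := by
    obtain ⟨u, hu⟩ := hlamu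
    have h1 := hle h
    rw [← hu] at h1
    exact (Ideal.unit_mul_mem_iff_mem _ u.isUnit).mp h1
  obtain ⟨α, β, hαβ⟩ := Ideal.mem_span_pair.mp hmem
  have hdvd : X ∣ Y ^ ν * (1 - β * Y) := ⟨α, by linear_combination (-1 : O) * hαβ⟩
  have hprime : Prime X := IsRegularLocalRing.prime_of_not_mem_sq hX hX2
  rcases hprime.dvd_or_dvd hdvd with h1 | h1
  · exact not_dvd_of_span_pair_eq hdim hXY (hprime.dvd_of_dvd_pow h1)
  · have hu : IsUnit (1 - β * Y) :=
      IsLocalRing.isUnit_one_sub_self_of_mem_nonunits (β * Y) ((IsLocalRing.mem_maximalIdeal _).mp (Ideal.mul_mem_left _ β hY))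
    exact (IsLocalRing.mem_maximalIdeal X).mp hX (isUnit_of_dvd_unit h1 hu)

end DimTwo

/-! ## §3 The induction step -/

section Step

variable {T : Type} [CommRing T] [IsRegularLocalRing T]

omit [IsRegularLocalRing T] in
/-- From `γ ≡ c (mod 𝔪_O)` to the corrected generator: if `Y/1 = a y₁ + γ X₀^k` and `γ - c/1 ∈ 𝔪_O = (X₀, Y) O` (`k ≥ 1`), then
`(Y - c X₀^k)/1 ∈ (y₁, X₀^{k+1}) O`. [folklore] -/
theorem algebraMap_sub_mul_pow_mem_span (P : Ideal T) [P.IsPrime] {X₀ Y : T} (hXY : Ideal.span {X₀, Y} = P)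
    {y₁ a γ : Localization.AtPrime P} {k : ℕ} (hk : 1 ≤ k)
    (haγ : a * y₁ + γ * algebraMap T (Localization.AtPrime P) X₀ ^ k = algebraMap T (Localization.AtPrime P) Y)
    {c : T} (hc : γ - algebraMap T (Localization.AtPrime P) c ∈ maximalIdeal (Localization.AtPrime P)) :
    algebraMap T (Localization.AtPrime P) (Y - c * X₀ ^ k) ∈
      Ideal.span {y₁, algebraMap T (Localization.AtPrime P) X₀ ^ (k + 1)} := by
  set φ := algebraMap T (Localization.AtPrime P) with hφ
  have h𝔪O : Ideal.span {φ X₀, φ Y} = maximalIdeal (Localization.AtPrime P) := by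
    rw [← map_span_pair, hXY, Localization.AtPrime.map_eq_maximalIdeal]
  have hX𝔪 : φ X₀ ∈ maximalIdeal (Localization.AtPrime P) := h𝔪O ▸ Ideal.subset_span (Set.mem_insert _ _)
  rw [← h𝔪O] at hc
  obtain ⟨lam, μ, hlm⟩ := Ideal.mem_span_pair.mp hc
  obtain ⟨k', rfl⟩ : ∃ k', k = k' + 1 := ⟨k - 1, by omega⟩
  have hu : IsUnit (1 - μ * φ X₀ ^ (k' + 1)) :=
    IsLocalRing.isUnit_one_sub_self_of_mem_nonunits _
      ((IsLocalRing.mem_maximalIdeal _).mp (Ideal.mul_mem_left _ μ (Ideal.pow_mem_of_mem _ hX𝔪 _ (Nat.succ_pos k'))))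
  rw [← Ideal.mul_unit_mem_iff_mem _ hu]
  have key : φ (Y - c * X₀ ^ (k' + 1)) * (1 - μ * φ X₀ ^ (k' + 1)) =
      a * y₁ + (lam + μ * φ c * φ X₀ ^ k') * φ X₀ ^ (k' + 1 + 1) := by
    have hγ : γ = lam * φ X₀ + μ * φ Y + φ c := by rw [← sub_eq_iff_eq_add.mp hlm.symm]
    have hY : φ Y = a * y₁ + γ * φ X₀ ^ (k' + 1) := haγ.symm
    rw [map_sub, map_mul, map_pow]
    have h1 : φ Y - φ c * φ X₀ ^ (k' + 1) = a * y₁ + (lam * φ X₀ + μ * φ Y) * φ X₀ ^ (k' + 1) := by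
      conv_lhs => rw [hY]
      rw [hγ]; ring
    linear_combination h1
  rw [key]
  exact Ideal.mem_span_pair.mpr ⟨a, _, rfl⟩

end Step

end Iota3

end Summit.ResolutionOfSingularities.ResolutionOfSingularities.Cruxes.HypersurfaceCentreConstruction.LocalEngine

end
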